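import Summits.ResolutionOfSingularities.ResolutionOfSingularities.Theorems.EquisingularLiftEquisingularLiftNatNDLeafInit
import Summits.ResolutionOfSingularities.ResolutionOfSingularities.Theorems.EquisingularLiftEquisingularLiftNatNDFrameRegular
import Summits.ResolutionOfSingularities.ResolutionOfSingularities.Theorems.EquisingularLiftEquisingularLiftNatNDInvariantsP
import HarnessLib

/-!
# [OURS · L1 W4.5(b) · EL♮(3)] R33 (β) «ND-LEAVES» / K6, R36–R36′ «K-LOC» (L-ℓ) — brick `…NatNDLeafInitP`: the LEAF-INIT SUPPLIER, POINTWISE form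
# (the `P` twin of ✓ p648153 `…NatNDLeafInit`: no ambient `Scheme.IsRegular F` anywhere)

Cell `res-hironaka`, crux EL♮(3) `EquisingularLiftNatThree` (stmt-ResolutionOfSingularities-20148), chain W4.5b.  res-L1-w45b-nose-w1 g0 (WIDTH seat).
OURS; NOT a statement of any manuscript; nothing of [Hironaka2017] is asserted; resolution of singularities in positive characteristic is NOT proved
here or by this; AI-written, weaker than expert review.  Def-free, `sorry`-free, standard axioms.  `--kind proof --supports stmt-ResolutionOfSingularities-20148 --as helper`.

Desk R36 (α) L0 (2026-08-28T16:24:52Z): the global conjunct `Scheme.IsRegular F` of `ND.NDInv` is localised away — the k-side needs regularity of a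
stage only AT the round points, where the frame data supply it (res-L1-w45b-iso-w1's R0 ✓ `…NatNDFrameRegular`).  The pointwise invariants
`ND.NDInvP`/`NDInvCP`/`NDInvCLNP` are lead-2's port ✓ `…NatNDInvariantsP` of idea-1's §P (`Cruxes/EquisingularLiftNatThree/NDLeavesRungK6Loc.lean`).
This file re-cuts the leaf-init supplier accordingly:
* `isRegularLocalRing_stalk_of_leafChart` — a LEAF CHART (`𝒪_{F,x}` = localisation of `k[t₁..tₙ]` at a rational point) makes `𝒪_{F,x}` regular BY
  ITSELF (maximal ideal generated by the `n` germs `χ(t_j − b_j)`, dimension `n`; R0 ring form by name);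
* `stalkIdeal_eq_span_of_leafChartP`, ★ `isNDFrameAt_of_leafChartP` — ✓ p648153's `stalkIdeal_eq_span_of_leafChart` / `isNDFrameAt_of_leafChart`
  with the binder `(hF : Scheme.IsRegular F)` DELETED and nothing else changed (factoriality of `𝒪_{F,x}` now from the chart);
* ★ `ndInvCLNP_of_leafFrames` — THE SOCKET over the port's `ND.NDInvCLNP` BY NAME: `T` closed, `F` locally Noetherian, a finite set `S` of closed points
  of the reduced closure `T̂` off which `T̂` is regular and on which it is not, `ND.IsNDFrameAt` data on `S` ⇒ `ND.NDInvCLNP n k |S| F ρ T`.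

References (mathematics): H. Matsumura, *Commutative Ring Theory* (1986), §5 Example 5.1, §14, Theorem 20.3 [Matsumura1987]; R. Hartshorne, *Algebraic
Geometry* (1977), II Example 3.2.6 [Hartshorne1977]; A. G. Kouchnirenko, Invent. Math. 32 (1976) 1–31 [Kouchnirenko1976].
-/

set_option linter.dupNamespace false

noncomputable section

open CategoryTheory AlgebraicGeometry TopologicalSpace IsLocalRing MvPolynomial
open AlgebraicGeometry.Scheme.IdealSheafData
open Literature.AlgebraicGeometry.Resolution
open Literature.AlgebraicGeometry.Motives

namespace Summit.ResolutionOfSingularities.ResolutionOfSingularities.Cruxes.EquisingularLiftNat.Sections.ND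

open Summit.ResolutionOfSingularities.ResolutionOfSingularities.Cruxes.EquisingularLiftNat.Sections

/-! ## §1 The supplier without ambient regularity -/

section Supplier

variable (n : ℕ) (k : Type) [Field k]

/-- The identity automorphism fixes the origin. [folklore] -/
theorem fixesOrigin_refl : FixesOrigin (AlgEquiv.refl : MvPolynomial (Fin n) k ≃ₐ[k] MvPolynomial (Fin n) k) :=
  fun j => by rw [AlgEquiv.coe_refl, id, constantCoeff_X]

/-- **`𝒪_{F,x}` is regular when presented by a leaf chart** (a localisation of `k[t₁, …, tₙ]` at a rational point): its maximal ideal is generated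
by the `n` germs `χ(t_j − b_j)` and its dimension is `n`. [cite: Matsumura1987, §14 (regular local rings), §5 Example 5.1] -/
theorem isRegularLocalRing_stalk_of_leafChart {F : Scheme.{0}} [IsLocallyNoetherian F] (x : F) (b : Fin n → k)
    (χ : MvPolynomial (Fin n) k →+* F.presheaf.stalk x)
    (hχ : letI := χ.toAlgebra; IsLocalization.AtPrime (F.presheaf.stalk x) (MvPolynomial.vanishingIdeal k {b})) :
    IsRegularLocalRing (F.presheaf.stalk x) := by
  classical
  letI := χ.toAlgebra
  haveI := hχ
  refine isRegularLocalRing_of_span_range_eq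
    (fun j => χ (translate (-b) ((AlgEquiv.refl : MvPolynomial (Fin n) k ≃ₐ[k] MvPolynomial (Fin n) k).symm (X j)))) ?_
    (ringKrullDim_stalk_eq_of_leafChart n k x b χ hχ)
  have h1 : Ideal.span (Set.range fun j =>
        χ (translate (-b) ((AlgEquiv.refl : MvPolynomial (Fin n) k ≃ₐ[k] MvPolynomial (Fin n) k).symm (X j)))) =
      (Ideal.span (Set.range fun j =>
        translate (-b) ((AlgEquiv.refl : MvPolynomial (Fin n) k ≃ₐ[k] MvPolynomial (Fin n) k).symm (X j)))).map χ := by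
    rw [Ideal.map_span, ← Set.range_comp]
    rfl
  rw [h1, span_range_recentre_eq_vanishingIdeal _ (fixesOrigin_refl n k) b]
  exact IsLocalization.AtPrime.map_eq_maximalIdeal (MvPolynomial.vanishingIdeal k ({b} : Set (Fin n → k))) (F.presheaf.stalk x)

/-- **`(𝓘_{T̂})_x = (χ f)` at a leaf, WITHOUT ambient regularity** (R36 L0: `𝒪_{F,x}` is regular by the chart itself,
`isRegularLocalRing_stalk_of_leafChart`, hence factorial). [OURS · K6 (K6-L1) P · ideal equality] -/
theorem stalkIdeal_eq_span_of_leafChartP [IsAlgClosed k] (hn : 2 ≤ n) {F : Scheme.{0}} (T : Set F)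
    [IsLocallyNoetherian F] (x : F) (b : Fin n → k) (χ : MvPolynomial (Fin n) k →+* F.presheaf.stalk x)
    (hχ : letI := χ.toAlgebra; IsLocalization.AtPrime (F.presheaf.stalk x) (MvPolynomial.vanishingIdeal k {b}))
    (f : MvPolynomial (Fin n) k)
    (hT : ∀ Q : Ideal (F.presheaf.stalk x), Q.IsPrime →
      (stalkIdeal (vanishingIdeal (⟨closure T, isClosed_closure⟩ : Closeds F)) x ≤ Q ↔ χ f ∈ Q))
    (θ : MvPolynomial (Fin n) k ≃ₐ[k] MvPolynomial (Fin n) k) (hθ : FixesOrigin θ) (hg : LocalND (θ (translate b f))) :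
    stalkIdeal (vanishingIdeal (⟨closure T, isClosed_closure⟩ : Closeds F)) x = Ideal.span {χ f} := by
  classical
  letI := χ.toAlgebra
  haveI := hχ
  haveI : IsRegularLocalRing (F.presheaf.stalk x) := isRegularLocalRing_stalk_of_leafChart n k x b χ hχ
  haveI : UniqueFactorizationMonoid (F.presheaf.stalk x) := IsRegularLocalRing.uniqueFactorizationMonoid (F.presheaf.stalk x)
  have hf0 : f ≠ 0 := by
    intro h
    apply ne_zero_of_isLocallyND hg.2
    rw [h, show translate b (0 : MvPolynomial (Fin n) k) = 0 from map_zero _, map_zero]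
  have hQ : ∀ p, p ∈ MvPolynomial.vanishingIdeal k ({b} : Set (Fin n → k)) ↔ MvPolynomial.eval b p = 0 := by
    intro p
    rw [MvPolynomial.mem_vanishingIdeal_singleton_iff]
    exact Iff.rfl
  have hsq : Squarefree (χ f) :=
    squarefree_algebraMap_of_forall_not_sq_dvd (MvPolynomial.vanishingIdeal k ({b} : Set (Fin n → k))) b hQ hf0 fun P hP hdvd =>
      sq_dvd_false_of_localND hn hg
        (show constantCoeff (θ (translate b P)) = 0 by
          rw [constantCoeff_apply_of_fixesOrigin θ hθ, constantCoeff_translate]; exact hP)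
        (by
          have h1 : translate b P * translate b P ∣ translate b f := by
            unfold translate; rw [← map_mul]; exact map_dvd _ hdvd
          rw [pow_two, ← map_mul]; exact map_dvd θ h1)
  have hrad : (Ideal.span {χ f}).IsRadical := isRadical_iff_span_singleton.mp hsq.isRadical
  exact stalkIdeal_vanishingIdeal_eq_span_of_forall_isPrime _ x (χ f) hT hrad

/-- **(K6-L1) P ★ `isNDFrameAt_of_leafChartP`** — `isNDFrameAt_of_leafChart` WITHOUT the ambient hypothesis `Scheme.IsRegular F` (R36 (α) L0:
regularity is needed only at `x`, and there it follows from the leaf chart). [OURS · K6 (K6-L1) P] -/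
theorem isNDFrameAt_of_leafChartP [IsAlgClosed k] (hn : 2 ≤ n) {F : Scheme.{0}} (ρ : F ⟶ (projectiveSpace n k).left) (T : Set F)
    [IsLocallyNoetherian F] (x : F) (b : Fin n → k) (χ : MvPolynomial (Fin n) k →+* F.presheaf.stalk x)
    (hχ : letI := χ.toAlgebra; IsLocalization.AtPrime (F.presheaf.stalk x) (MvPolynomial.vanishingIdeal k {b}))
    (hC : χ.comp MvPolynomial.C = baseToStalk n k ρ x) (f : MvPolynomial (Fin n) k)
    (hT : ∀ Q : Ideal (F.presheaf.stalk x), Q.IsPrime →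
      (stalkIdeal (vanishingIdeal (⟨closure T, isClosed_closure⟩ : Closeds F)) x ≤ Q ↔ χ f ∈ Q))
    (θ : MvPolynomial (Fin n) k ≃ₐ[k] MvPolynomial (Fin n) k) (hθ : FixesOrigin θ) (hg : LocalNDWon (θ (translate b f))) :
    ∃ W : Fin n → F.IdealSheafData, IsNDFrameAt n k ρ T W x := by
  obtain ⟨W, w, -, h2, h3, h4, h5⟩ := exists_frame_of_leafChart n k ρ x b χ hχ hC θ hθ
  refine ⟨W, w, θ (translate b f), h2, h3, h4, hg, ?_⟩
  rw [h5 f]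
  exact stalkIdeal_eq_span_of_leafChartP n k hn T x b χ hχ f hT θ hθ hg.1


end Supplier

/-! ## §2 The socket over `ND.NDInvCLNP` -/

section Socket

variable (n : ℕ) (k : Type) [Field k]

/-- **★ `ndInvCLNP_of_leafFrames` — THE SOCKET, POINTWISE form** (R36 L0; port ✓ `…NatNDInvariantsP`).  At a k-side stage `(F, ρ, T)` with `F` locally
Noetherian and `T` closed — NO global regularity of `F` —: a finite set `S` of CLOSED points of `F` on the reduced closure `T̂` of `T`, off which `T̂` is
regular and on which it is not, each carrying local ND frame data `ND.IsNDFrameAt n k ρ T W x` ⇒ `ND.NDInvCLNP n k |S| F ρ T`. [OURS · K6 · packaging] -/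
theorem ndInvCLNP_of_leafFrames (F : Scheme.{0}) (ρ : F ⟶ (projectiveSpace n k).left) (T : Set F) [IsLocallyNoetherian F] (hT : IsClosed T)
    (S : Finset F)
    (hS : ∀ z : ↥(vanishingIdeal (⟨closure T, isClosed_closure⟩ : Closeds F)).subscheme,
      IsRegularLocalRing ((vanishingIdeal (⟨closure T, isClosed_closure⟩ : Closeds F)).subscheme.presheaf.stalk z) ↔
        ((vanishingIdeal (⟨closure T, isClosed_closure⟩ : Closeds F)).subschemeι z : F) ∉ S)
    (hS' : ∀ x ∈ S, (∃ z : ↥(vanishingIdeal (⟨closure T, isClosed_closure⟩ : Closeds F)).subscheme,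
        ((vanishingIdeal (⟨closure T, isClosed_closure⟩ : Closeds F)).subschemeι z : F) = x) ∧ IsClosed ({x} : Set F) ∧
      ∃ W : Fin n → F.IdealSheafData, IsNDFrameAt n k ρ T W x) :
    NDInvCLNP n k S.card F ρ T :=
  ⟨⟨⟨S, rfl, hS, hS'⟩, hT⟩, inferInstance⟩

/-- The pointwise invariant still gives regularity of `𝒪_{F,x}` at every point of `S` (R0 by name) — the only place the k-side ever used it. [OURS] -/
theorem isRegularLocalRing_stalk_of_ndInvP {F : Scheme.{0}} [IsLocallyNoetherian F] {ρ : F ⟶ (projectiveSpace n k).left} {T : Set F} {m : ℕ}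
    (h : NDInvP n k m F ρ T) : ∃ S : Finset F, S.card = m ∧ ∀ x ∈ S, IsRegularLocalRing (F.presheaf.stalk x) := by
  obtain ⟨S, hS, -, hS'⟩ := h
  refine ⟨S, hS, fun x hx => ?_⟩
  obtain ⟨-, -, W, hW⟩ := hS' x hx
  exact isRegularLocalRing_of_isNDFrameAt n k hW

end Socket

end Summit.ResolutionOfSingularities.ResolutionOfSingularities.Cruxes.EquisingularLiftNat.Sections.ND

end
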